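import Mathlib.FieldTheory.Galois.Basic
import Mathlib.RingTheory.PowerSeries.Inverse
import Literature.NumberTheory.GaloisRepresentations.LubinTateColeman
import HarnessLib

/-!
# Coleman's norm operator for `f = πX + X^q`: the Coleman family `W_f^1 ⊆ 𝔪_{K_π^{n+1}}` and the
descent of `𝒩h` to `𝒪[F]⟦X⟧`

Step P3 (concrete layer, first half) of the programme of `LocalExistenceLubinTate.lean` towards the
norm-group fact `Literature.NumberTheory.GaloisRepresentations.exists_abelian_norm_le_lubinTate`
(`N(K_π^nˣ) ⊆ ⟨π⟩ · U^{(n)}`, Cassels–Fröhlich VI §3.6–3.8).  `LubinTateColeman.lean` builds, for an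
abstract *Coleman family* `W = (ωᵢ)` of roots of `f` in a closed nil ideal `M ⊆ 𝒪_L`
(`LubinTate.IsColemanFamily`), Coleman's series `colemanSer hW h ∈ 𝒪_L⟦X⟧` with
`colemanSer hW h ∘ f = ∏ᵢ h(X [+] ωᵢ)` (de Shalit, *Iwasawa theory of elliptic curves with complex
multiplication* (1987), Ch. I §2.1 (1)).  Here, for a non-archimedean local field `F`, a uniformizer
`π`, `f = πX + X^q` and the Lubin–Tate field `E = K_π^{n+1} = F(λ_{n+1})` (`ltField π n`,
`LubinTateField.lean`; `λ = genPt hπ n ∈ 𝔪_E`, `LubinTateTorsion.lean`), everything **proved**: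

* `Literature.NumberTheory.GaloisRepresentations.ltDivPt hπ n : 𝓀[F] → 𝔪_E`, the `π`-division points
  `ω_c = [π^n · digit c] λ_{n+1}` (`residueDigit` a section of the residue map with `residueDigit 0 = 0`), and
  `isColemanFamily_ltDivPt` — **`W_f^1` is a Coleman family** (the model promised in
  `LubinTateColeman.lean`): `[π] ω_c = 0`, `ω_c [+] ω_j = ω_{c+j}`, `c ↦ ω_c` injective, and
  `f = ∏_c (X - ω_c)` over `𝒪_E` (`map_ltPoly_eq_prod`: the `q` distinct roots of the monic `f`;
  Cassels–Fröhlich VI §3.6 Prop. 6 (a)).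
* `seriesGalMap σ` — an `F`-automorphism `σ ∈ G(E/F)` acting coefficientwise on `𝒪_E⟦X⟧` (a continuous
  algebra map over the coefficient ring); it commutes with evaluation (`algHom_evalPt`,
  `algHom_evalAt`), fixes `X [+] ω ↦ X [+] σω` (`seriesGalMapPt_tPt`), translates (`seriesGalMap_transl`),
  permutes `W_f^1` (`exists_perm_mapPt_ltDivPt`, via `exists_eq_ltDivPt`: every `π`-division point of `𝔪_E` is
  an `ω_c`), hence fixes the Coleman product and — by uniqueness of the solution of (1)
  (`subst_injective_of_isDomain`) — **fixes `colemanSer`** (`seriesGalMap_colemanSer`).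
* `Literature.NumberTheory.GaloisRepresentations.colemanNorm hπ n h ∈ 𝒪[F]⟦X⟧` — **Coleman's norm operator
  `𝒩` on `𝒪[F]⟦X⟧`**, the Galois descent of `colemanSer` (`exists_algebraMap_eq_of_fixed`: `E/F` is
  Galois, `isGalois_ltField`, and `G(E/F)`-fixed elements of `𝒪_E` lie in `𝒪[F]`), with
  `map_colemanNorm : ι(𝒩h) = colemanSer`.  Its properties ((1) at points, multiplicativity, de Shalit's
  (i), (iii), (iv)) and the norm computation follow in `LubinTateNormOperator.lean` and
  `LubinTateNormGroup.lean`.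

Generic supplements to the Coleman layer: `evalAt_eq_evS_map`, `evalAt_zero` (`h(0) = h₀`),
`IsLTSeries.map`, `subst_injective_of_isDomain`, `ltSMul_eq_of_dvd_sub`; and `ltSer F π`, the series
`f` with its proper type `PowerSeries (LTCoeff F)` (reducible; definitionally the series of
`isLTSeries_LTCoeff`, so that all point identities of `LubinTateTorsion.lean` apply verbatim).

## References

* E. de Shalit, *Iwasawa theory of elliptic curves with complex multiplication*, Perspectives in
  Math. 3, Academic Press (1987), Ch. I §1.7–1.8 (PDF p. 11), §2.1 Proposition and its proof
  (PDF pp. 12–13).  [deShalit1987]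
* J.-P. Serre, *Local class field theory*, Ch. VI of Cassels–Fröhlich, *Algebraic Number Theory*
  (1967), §3.6 Prop. 6.  [CasselsFrohlichANT1967]
* J.-P. Serre, *Local Fields* (1979), Ch. II §4 Prop. 5 (`π`-adic digits).  [SerreLocalFields1979]

## Mathlib reuse

`PowerSeries.mapAlgHom`, `PowerSeries.map_subst`, `MvPowerSeries.comp_aeval`,
`IsGalois.mem_range_algebraMap_iff_fixed`, `Polynomial.eq_zero_of_natDegree_lt_card_of_eval_eq_zero`,
`Polynomial.degree_sub_lt`, `Finite.injective_iff_bijective`, `Equiv.prod_comp`; from the tree: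
`LubinTateColeman.lean` (`colemanSer`, `subst_colemanSer`, `nProd`, `transl`, `tPt`, `evalAt`, `evS`,
`coeff_self_pow`, `coe_prod_X_sub_C`, `coe_map_polynomial`), `LubinTateTorsion.lean` (`genPt`,
`ltSMul_pow_genPt`, `pow_dvd_sub_of_ltSMul_genPt_eq`, `coe_ltSMul_pi`, `toUnitBallHom`, `mapPt`,
`toUnitBallHom_ltSMul`, `isGalois_ltField`, `LTCoeff`, `maxNilIdeal`, local instances `rk1 nF nE`).
-/

noncomputable section

open Filter Topology Polynomial ValuativeRel
open scoped PowerSeries.WithPiTopology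

namespace Literature.NumberTheory.GaloisRepresentations

namespace LubinTate

/-! ### Generic supplements to the Coleman layer -/

section Generic

variable {A : Type*} [CommRing A] [UniformSpace A] [DiscreteUniformity A]
variable {S : Type*} [CommRing S] [UniformSpace S] [IsUniformAddGroup S] [IsTopologicalRing S]
  [IsLinearTopology S S] [T2Space S] [CompleteSpace S] [Algebra A S] [ContinuousSMul A S]
variable (M : NilIdeal S)

/-- Evaluation of an `A`-series at a point `y` is evaluation of its coefficientwise image at `y`.
[folklore] -/
theorem evalAt_eq_evS_map (y : M.toIdeal) (h : PowerSeries A) :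
    evalAt M y h = evS M y (h.map (algebraMap A S)) := by
  rw [← evalAt_serX M h, evS_evalAt, evSPt_serX]

/-- **Evaluation at `0` is the constant coefficient**: `h(0) = h₀`. [folklore] -/
theorem evalAt_zero (h : PowerSeries A) :
    evalAt M (0 : M.toIdeal) h = algebraMap A S (PowerSeries.constantCoeff h) := by
  rw [evalAt_eq_evS_map, evS_zero_eq, ← PowerSeries.coeff_zero_eq_constantCoeff_apply,
    PowerSeries.coeff_map, PowerSeries.coeff_zero_eq_constantCoeff_apply]

variable {T : Type*} [CommRing T] [UniformSpace T] [IsUniformAddGroup T] [IsTopologicalRing T]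
  [IsLinearTopology T T] [T2Space T] [CompleteSpace T] [Algebra A T] [ContinuousSMul A T]
  (M' : NilIdeal T)

/-- **Continuous `A`-algebra maps commute with evaluation** (several variables): if `ε(xᵢ) = x'ᵢ`
then `ε(G(x)) = G(x')`. [folklore] -/
theorem algHom_evalPt {ι : Type*} [Finite ι] (ε : S →ₐ[A] T) (hε : Continuous ε)
    (G : MvPowerSeries ι A) (hG : G.constantCoeff = 0) (x : ι → M.toIdeal) (x' : ι → M'.toIdeal)
    (h : ∀ i, ε (x i) = x' i) : ε (evalPt M G hG x) = evalPt M' G hG x' := by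
  rw [coe_evalPt, coe_evalPt]
  have h1 := congrArg (fun φ => φ G) (MvPowerSeries.comp_aeval (M.hasEval x) hε)
  simp only [AlgHom.coe_comp, Function.comp_apply] at h1
  rw [h1]
  exact aeval_congr_family _ _ (funext h) G

/-- **Continuous `A`-algebra maps commute with evaluation** (one variable): if `ε(x) = x'` then
`ε(h(x)) = h(x')`. [folklore] -/
theorem algHom_evalAt (ε : S →ₐ[A] T) (hε : Continuous ε) (h : PowerSeries A) (x : M.toIdeal)
    (x' : M'.toIdeal) (hx : ε x = x') : ε (evalAt M x h) = evalAt M' x' h := by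
  rw [evalAt_apply, evalAt_apply, PowerSeries.aeval, PowerSeries.aeval]
  have h1 := congrArg (fun φ => φ (h : MvPowerSeries Unit A))
    (MvPowerSeries.comp_aeval (PowerSeries.hasEval (M.isTopologicallyNilpotent _ x.2)) hε)
  simp only [AlgHom.coe_comp, Function.comp_apply] at h1
  rw [h1]
  exact aeval_congr_family _ _ (funext fun _ => hx) _

omit [UniformSpace A] [DiscreteUniformity A] in
/-- An LT series stays an LT series under a ring map. [folklore] -/
theorem IsLTSeries.map {π : A} {q : ℕ} {f : PowerSeries A} (hf : IsLTSeries π q f)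
    {B : Type*} [CommRing B] (φ : A →+* B) : IsLTSeries (φ π) q (f.map φ) := by
  refine ⟨?_, ?_, fun n => ?_⟩
  · rw [← PowerSeries.coeff_zero_eq_constantCoeff_apply, PowerSeries.coeff_map,
      PowerSeries.coeff_zero_eq_constantCoeff_apply, hf.constantCoeff_eq_zero, map_zero]
  · rw [PowerSeries.coeff_map, hf.coeff_one]
  · rw [PowerSeries.coeff_map]
    obtain ⟨c, hc⟩ := hf.dvd_coeff_sub n
    refine ⟨φ c, ?_⟩
    rw [← map_mul, ← hc, map_sub]
    split_ifs <;> simp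

omit [UniformSpace S] [IsUniformAddGroup S] [IsTopologicalRing S] [IsLinearTopology S S] [T2Space S]
  [CompleteSpace S] [Algebra A S] [ContinuousSMul A S] in
/-- **`g ↦ g ∘ f` is injective** over a domain, for `f` an LT series with `π ≠ 0` (the leading term
of `g ∘ f` is `g_k π^k X^k`). [cite: deShalit1987, Ch. I §2.1] -/
theorem subst_injective_of_isDomain [IsDomain S] {π : S} {q : ℕ} {f : PowerSeries S}
    (hπ : π ≠ 0) (hf : IsLTSeries π q f) :
    Function.Injective (fun g : PowerSeries S => PowerSeries.subst f g) := by
  have hfs : PowerSeries.HasSubst f := PowerSeries.HasSubst.of_constantCoeff_zero' hf.constantCoeff_eq_zero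
  intro g g' hgg'
  rw [← sub_eq_zero]
  set D := g - g'
  have hD : PowerSeries.subst f D = 0 := by
    simp only [D, PowerSeries.subst_sub hfs]
    exact sub_eq_zero.mpr hgg'
  by_contra hne
  have hex : ∃ n, PowerSeries.coeff n D ≠ 0 := by
    by_contra hall
    push Not at hall
    exact hne (PowerSeries.ext fun n => by rw [hall n, map_zero])
  classical
  let n₀ := Nat.find hex
  have hn₀ : PowerSeries.coeff n₀ D ≠ 0 := Nat.find_spec hex
  have hlt : ∀ m < n₀, PowerSeries.coeff m D = 0 := fun m hm => by
    have := Nat.find_min hex hm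
    push Not at this
    exact this
  have hc := congrArg (PowerSeries.coeff n₀) hD
  rw [map_zero, PowerSeries.coeff_subst' hfs,
    finsum_eq_sum_of_support_subset _ (s := Finset.range (n₀ + 1)), Finset.sum_range_succ,
    Finset.sum_eq_zero, zero_add, coeff_self_pow hf, smul_eq_mul] at hc
  · exact hn₀ ((mul_eq_zero.mp hc).resolve_right (pow_ne_zero _ hπ))
  · intro m hm
    rw [hlt m (Finset.mem_range.mp hm), zero_smul]
  · intro d hd
    rw [Function.mem_support] at hd
    rw [Finset.coe_range, Set.mem_Iio]
    by_contra hnd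
    push Not at hnd
    exact hd (by rw [coeff_pow_eq_zero_of_constantCoeff_eq_zero hf.constantCoeff_eq_zero (by omega),
      smul_zero])

/-- `[a] x = [b] x` when `[c] x = 0` and `c ∣ a - b`. [folklore] -/
theorem ltSMul_eq_of_dvd_sub {π : A} {q : ℕ} (hA : IsLTRing π q) {f : PowerSeries A}
    (hf : IsLTSeries π q f) {x : M.toIdeal} {c : A} (hx : ltSMul M hA hf c x = 0) {a b : A}
    (h : c ∣ a - b) : ltSMul M hA hf a x = ltSMul M hA hf b x := by
  obtain ⟨e, he⟩ := h
  rw [show a = b + e * c by rw [← sub_eq_iff_eq_add', he, mul_comm], add_ltSMul, mul_ltSMul, hx,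
    ltSMul_zero, ltAdd_zero]

end Generic

end LubinTate

/-! ### The `π`-division points of `F_f` in `K_π^{n+1}` as a Coleman family -/

section LocalField

open GaloisRepresentations.IsNonarchimedeanLocalField LubinTate

variable (F : Type*) [Field F] [ValuativeRel F] [TopologicalSpace F] [IsNonarchimedeanLocalField F]

/-- A section of the residue map `𝒪[F] → 𝓀[F]` with `residueDigit 0 = 0` (the "digits" of `π`-adic
expansions). Ref: Serre, *Local Fields*, Ch. II §4 Prop. 5. [folklore] -/
def residueDigit (c : 𝓀[F]) : 𝒪[F] :=
  haveI := Classical.dec (c = 0)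
  if c = 0 then 0 else Function.surjInv (IsLocalRing.residue_surjective (R := 𝒪[F])) c

/-- `residueDigit c` lifts `c`. [folklore] -/
theorem residue_residueDigit (c : 𝓀[F]) : IsLocalRing.residue 𝒪[F] (residueDigit F c) = c := by
  unfold residueDigit
  split_ifs with h
  · rw [map_zero, h]
  · exact Function.surjInv_eq (IsLocalRing.residue_surjective (R := 𝒪[F])) c

/-- `residueDigit 0 = 0`. [folklore] -/
theorem residueDigit_zero : residueDigit F (0 : 𝓀[F]) = 0 := by
  unfold residueDigit; exact if_pos rfl

/-- The Lubin–Tate series `f = πX + X^q` over the discrete coefficient ring `LTCoeff F = 𝒪[F]`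
(the power series of `ltPoly F π`; reducible, definitionally the series of `isLTSeries_LTCoeff`).
[cite: CasselsFrohlichANT1967, Ch. VI §3.3 Example (a)] -/
abbrev ltSer (π : 𝒪[F]) : PowerSeries (LTCoeff F) := ((ltPoly F π : 𝒪[F][X]) : PowerSeries 𝒪[F])

variable {F} in
/-- `f = πX + X^q ∈ 𝔉_π` over `LTCoeff F` (restating `isLTSeries_LTCoeff`). [folklore] -/
theorem isLTSeries_ltSer (π : 𝒪[F]) : IsLTSeries (LTCoeff.of F π) (residueFieldCard F) (ltSer F π) :=
  isLTSeries_LTCoeff π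

/-- The uniform structure of `F` (local instance, defeq to the valuative topology; the same term as
the anonymous local instance of `LubinTateTorsion.lean`). [folklore] -/
local instance ltNormUniformSpace : UniformSpace F := IsTopologicalAddGroup.rightUniformSpace F
/-- (local) the uniform structure of `F` is a group uniformity. [folklore] -/
local instance ltNormIsUniformAddGroup : IsUniformAddGroup F := isUniformAddGroup_of_addCommGroup
attribute [local instance] rk1 nF nE

/-- The (finite) residue field as a `Fintype` (local instance). [folklore] -/
local instance fintypeResidueField : Fintype 𝓀[F] := Fintype.ofFinite _

section Family

variable {F}
variable {π : 𝒪[F]} (hπ : (valuation F).IsUniformizer (π : F))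

/-- `[a] λ_{n+1} = [b] λ_{n+1}` when `a ≡ b (mod π^{n+1})`. [cite: CasselsFrohlichANT1967, Ch. VI §3.6 Prop. 6 (a)] -/
theorem ltSMul_genPt_eq_of_pow_dvd_sub {n : ℕ} {a b : 𝒪[F]} (h : π ^ (n + 1) ∣ a - b) :
    ltSMul (maxNilIdeal F (ltField π n)) (isLTRing_LTCoeff hπ) (isLTSeries_LTCoeff π)
        (LTCoeff.of F a) (genPt hπ n) =
      ltSMul (maxNilIdeal F (ltField π n)) (isLTRing_LTCoeff hπ) (isLTSeries_LTCoeff π)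
        (LTCoeff.of F b) (genPt hπ n) := by
  refine ltSMul_eq_of_dvd_sub _ (isLTRing_LTCoeff hπ) (isLTSeries_LTCoeff π)
    (c := LTCoeff.of F π ^ (n + 1)) (ltSMul_pow_genPt hπ n) ?_
  rw [← map_pow, ← map_sub]
  exact map_dvd _ h

/-- **The `π`-division points `W_f^1 ⊆ 𝔪_{K_π^{n+1}}`**, indexed by the residue field:
`ω_c = [π^n · residueDigit c] λ_{n+1}`. [cite: CasselsFrohlichANT1967, Ch. VI §3.6 Prop. 6 (a)] -/
def ltDivPt (n : ℕ) (c : 𝓀[F]) : (maxNilIdeal F (ltField π n)).toIdeal :=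
  ltSMul (maxNilIdeal F (ltField π n)) (isLTRing_LTCoeff hπ) (isLTSeries_LTCoeff π)
    (LTCoeff.of F (π ^ n * residueDigit F c)) (genPt hπ n)

/-- `[π] ω_c = 0`. [folklore] -/
theorem ltSMul_ltDivPt (n : ℕ) (c : 𝓀[F]) :
    ltSMul (maxNilIdeal F (ltField π n)) (isLTRing_LTCoeff hπ) (isLTSeries_LTCoeff π)
      (LTCoeff.of F π) (ltDivPt hπ n c) = 0 := by
  rw [ltDivPt, ← mul_ltSMul, ← map_mul, show π * (π ^ n * residueDigit F c) = residueDigit F c * π ^ (n + 1) by ring,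
    map_mul, mul_ltSMul, map_pow, ltSMul_pow_genPt hπ n, ltSMul_zero]

/-- Translation by `ω_c` permutes the family: `ω_c [+] ω_j = ω_{c+j}`. [folklore] -/
theorem ltAdd_ltDivPt (n : ℕ) (c j : 𝓀[F]) :
    ltAdd (maxNilIdeal F (ltField π n)) (isLTRing_LTCoeff hπ) (isLTSeries_LTCoeff π)
      (ltDivPt hπ n c) (ltDivPt hπ n j) = ltDivPt hπ n (c + j) := by
  rw [ltDivPt, ltDivPt, ltDivPt, ← add_ltSMul, ← map_add]
  refine ltSMul_genPt_eq_of_pow_dvd_sub hπ ?_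
  rw [← mul_add, ← mul_sub, pow_succ]
  refine mul_dvd_mul_left _ (dvd_of_mem_maximalIdeal F hπ ?_)
  rw [← IsLocalRing.residue_eq_zero_iff, map_sub, map_add, residue_residueDigit, residue_residueDigit,
    residue_residueDigit, sub_self]

/-- The family `ω` is injective. [folklore] -/
theorem ltDivPt_injective (n : ℕ) : Function.Injective (ltDivPt hπ n) := by
  intro c j h
  have h1 := pow_dvd_sub_of_ltSMul_genPt_eq hπ h
  rw [← mul_sub, pow_succ] at h1
  have hπ0 : π ≠ 0 := fun h0 => hπ.ne_zero (congrArg Subtype.val h0)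
  have h2 : π ∣ residueDigit F c - residueDigit F j := (mul_dvd_mul_iff_left (pow_ne_zero n hπ0)).mp h1
  have h3 : residueDigit F c - residueDigit F j ∈ 𝓂[F] := by
    obtain ⟨e, he⟩ := h2
    rw [he]
    exact Ideal.mul_mem_right _ _
      ((mem_maximalIdeal_iff_valuation_lt_one _).mpr hπ.val_lt_one)
  rw [← IsLocalRing.residue_eq_zero_iff, map_sub, residue_residueDigit, residue_residueDigit, sub_eq_zero] at h3
  exact h3

/-- The `ω_c` are roots of `f = πX + X^q` (as a polynomial over `𝒪_E`). [folklore] -/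
theorem eval_ltDivPt_map_ltPoly (n : ℕ) (c : 𝓀[F]) :
    ((ltPoly F π).map (algebraMap 𝒪[F] (unitBall (ltField π n)))).eval
      ((ltDivPt hπ n c : (maxNilIdeal F (ltField π n)).toIdeal) : unitBall (ltField π n)) = 0 := by
  apply Subtype.ext
  rw [eval_map_algebraMap, coe_aeval_integer, ZeroMemClass.coe_zero, ← coe_ltSMul_pi hπ,
    ltSMul_ltDivPt]
  rfl

/-- **`f = ∏_c (X - ω_c)` over `𝒪_{K_π^{n+1}}`**: the `q` distinct roots `ω_c` of the monic
degree-`q` polynomial `f = πX + X^q`. [cite: CasselsFrohlichANT1967, Ch. VI §3.6 Prop. 6 (a)] -/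
theorem map_ltPoly_eq_prod (n : ℕ) :
    (ltPoly F π).map (algebraMap 𝒪[F] (unitBall (ltField π n))) =
      ∏ c : 𝓀[F], (X - C ((ltDivPt hπ n c : (maxNilIdeal F (ltField π n)).toIdeal) :
        unitBall (ltField π n))) := by
  classical
  set S := unitBall (ltField π n)
  set P := (ltPoly F π).map (algebraMap 𝒪[F] S) with hP
  set P' : S[X] := ∏ c : 𝓀[F], (X - C ((ltDivPt hπ n c : (maxNilIdeal F (ltField π n)).toIdeal) : S))
    with hP'
  have hq : 1 < residueFieldCard F := one_lt_residueFieldCard F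
  have hcard : Fintype.card 𝓀[F] = residueFieldCard F := by
    rw [residueFieldCard, Nat.card_eq_fintype_card]
  -- `f` is monic of degree `q`
  have hf : (ltPoly F π).Monic ∧ (ltPoly F π).natDegree = residueFieldCard F := by
    have hlt : (C π * X).degree < (X ^ residueFieldCard F : 𝒪[F][X]).degree := by
      rw [degree_X_pow]
      refine (degree_C_mul_X_le π).trans_lt ?_
      exact_mod_cast hq
    refine ⟨?_, ?_⟩
    · rw [ltPoly, Monic, leadingCoeff_add_of_degree_lt hlt, leadingCoeff_X_pow]
    · rw [ltPoly, natDegree_add_eq_right_of_degree_lt hlt, natDegree_X_pow]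
  have hPm : P.Monic := hf.1.map _
  have hPd : P.natDegree = residueFieldCard F := by rw [hP, hf.1.natDegree_map, hf.2]
  have hP'm : P'.Monic := monic_prod_of_monic _ _ fun c _ => monic_X_sub_C _
  have hP'd : P'.natDegree = residueFieldCard F := by
    rw [hP', natDegree_prod_of_monic _ _ fun c _ => monic_X_sub_C _]
    simp only [natDegree_X_sub_C, Finset.sum_const, Finset.card_univ, smul_eq_mul, mul_one, hcard]
  -- both vanish on the injective family `ω`
  have hinj : Function.Injective fun c : 𝓀[F] =>
      ((ltDivPt hπ n c : (maxNilIdeal F (ltField π n)).toIdeal) : S) :=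
    fun c j h => ltDivPt_injective hπ n (Subtype.ext h)
  have heval : ∀ c : 𝓀[F], (P - P').eval ((ltDivPt hπ n c : (maxNilIdeal F (ltField π n)).toIdeal) : S)
      = 0 := by
    intro c
    rw [eval_sub, hP, eval_ltDivPt_map_ltPoly, zero_sub, neg_eq_zero, hP', eval_prod]
    exact Finset.prod_eq_zero (Finset.mem_univ c) (by rw [eval_sub, eval_X, eval_C, sub_self])
  by_contra hne
  have hne' : P - P' ≠ 0 := sub_ne_zero.mpr hne
  have hdeg : (P - P').natDegree < Fintype.card 𝓀[F] := by
    have h1 : (P - P').degree < P.degree :=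
      degree_sub_lt (by rw [degree_eq_natDegree hPm.ne_zero, degree_eq_natDegree hP'm.ne_zero,
        hPd, hP'd]) hPm.ne_zero (by rw [hPm.leadingCoeff, hP'm.leadingCoeff])
    rw [degree_eq_natDegree hPm.ne_zero, hPd] at h1
    rw [hcard]
    exact (natDegree_lt_iff_degree_lt hne').mpr h1
  exact hne' (eq_zero_of_natDegree_lt_card_of_eval_eq_zero _ hinj heval hdeg)

/-- `f` over `𝒪_{K_π^{n+1}}` as a power series is `∏_c (X - C ω_c)`. [folklore] -/
theorem map_ltSeries_eq_prod (n : ℕ) :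
    (ltSer F π).map (algebraMap (LTCoeff F) (unitBall (ltField π n))) =
      ∏ c : 𝓀[F], (PowerSeries.X - PowerSeries.C
        ((ltDivPt hπ n c : (maxNilIdeal F (ltField π n)).toIdeal) : unitBall (ltField π n))) := by
  classical
  rw [← coe_prod_X_sub_C Finset.univ, ← map_ltPoly_eq_prod hπ n, coe_map_polynomial]
  rfl

/-- **`W_f^1 ⊆ 𝔪_{K_π^{n+1}}` is a Coleman family** for `f = πX + X^q`: the hypotheses of
`LubinTate.IsColemanFamily` (the model promised in `LubinTateColeman.lean`).
[cite: deShalit1987, Ch. I §2.1] -/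
theorem isColemanFamily_ltDivPt (n : ℕ) :
    IsColemanFamily (maxNilIdeal F (ltField π n)) (isLTRing_LTCoeff hπ) (isLTSeries_LTCoeff π)
      (ltDivPt hπ n) := by
  refine ⟨fun c => ltSMul_ltDivPt hπ n c, fun c => ⟨Equiv.addLeft c, fun j => ltAdd_ltDivPt hπ n c j⟩,
    ltDivPt_injective hπ n, ?_⟩
  exact map_ltSeries_eq_prod hπ n

end Family

section Descent

variable {F}
variable (E : IntermediateField F (AlgebraicClosure F)) [FiniteDimensional F E]

/-! #### Automorphisms acting on `𝒪_E⟦X⟧` -/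

variable {E} in
/-- An `F`-automorphism `σ` of `E` acting coefficientwise on `𝒪_E⟦X⟧`, as a continuous algebra map
over the coefficient ring `𝒪[F]`. [folklore] -/
def seriesGalMap (σ : E ≃ₐ[F] E) : PowerSeries (unitBall E) →ₐ[LTCoeff F] PowerSeries (unitBall E) :=
  PowerSeries.mapAlgHom (toUnitBallHom σ)

variable {E}

/-- `seriesGalMap σ` is `PowerSeries.map σ` (unfolding). [folklore] -/
theorem seriesGalMap_apply (σ : E ≃ₐ[F] E) (G : PowerSeries (unitBall E)) :
    seriesGalMap σ G = G.map (toUnitBallHom σ : unitBall E →+* unitBall E) := by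
  rw [seriesGalMap, PowerSeries.mapAlgHom_apply]

/-- Coefficients of `seriesGalMap σ G`. [folklore] -/
theorem coeff_seriesGalMap (σ : E ≃ₐ[F] E) (G : PowerSeries (unitBall E)) (k : ℕ) :
    PowerSeries.coeff k (seriesGalMap σ G) = toUnitBallHom σ (PowerSeries.coeff k G) := by
  rw [seriesGalMap_apply, PowerSeries.coeff_map]; rfl

/-- `seriesGalMap σ` is continuous (product topology; `σ` is an isometry). [folklore] -/
theorem continuous_seriesGalMap (σ : E ≃ₐ[F] E) : Continuous (seriesGalMap (F := F) σ) := by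
  refine continuous_pi fun d => ?_
  have : (fun G : PowerSeries (unitBall E) => (seriesGalMap σ G) d) =
      fun G => toUnitBallHom σ (G d) := by
    funext G
    exact MvPowerSeries.coeff_map _ _ _
  rw [this]
  exact (continuous_toUnitBallHom σ).comp (continuous_apply d)

/-- `σ` fixes series with coefficients from `𝒪[F]`. [folklore] -/
theorem seriesGalMap_map (σ : E ≃ₐ[F] E) (g : PowerSeries (LTCoeff F)) :
    seriesGalMap σ (g.map (algebraMap (LTCoeff F) (unitBall E))) =
      g.map (algebraMap (LTCoeff F) (unitBall E)) := by
  rw [seriesGalMap_apply, ← RingHom.comp_apply, ← PowerSeries.map_comp, (toUnitBallHom σ).comp_algebraMap]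

/-- `σ(X) = X`. [folklore] -/
theorem seriesGalMap_X (σ : E ≃ₐ[F] E) : seriesGalMap σ (PowerSeries.X : PowerSeries (unitBall E)) = PowerSeries.X := by
  rw [seriesGalMap_apply, PowerSeries.map_X]

/-- `σ(C s) = C (σ s)`. [folklore] -/
theorem seriesGalMap_C (σ : E ≃ₐ[F] E) (s : unitBall E) :
    seriesGalMap σ (PowerSeries.C s) = PowerSeries.C (toUnitBallHom σ s) := by
  rw [seriesGalMap_apply, PowerSeries.map_C]; rfl

/-- `σ` of a point of `𝒪_E⟦X⟧` (constant coefficient in `𝔪_E`) is again a point. [folklore] -/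
def seriesGalMapPt (σ : E ≃ₐ[F] E) (t : (seriesNilIdeal (maxNilIdeal F E)).toIdeal) :
    (seriesNilIdeal (maxNilIdeal F E)).toIdeal :=
  ⟨seriesGalMap σ t, by
    rw [mem_seriesNilIdeal_iff, ← PowerSeries.coeff_zero_eq_constantCoeff_apply, coeff_seriesGalMap,
      PowerSeries.coeff_zero_eq_constantCoeff_apply]
    exact (mapPt σ (ccPt (maxNilIdeal F E) t)).2⟩

/-- `seriesGalMapPt` is `seriesGalMap` (unfolding). [folklore] -/
@[simp] theorem coe_seriesGalMapPt (σ : E ≃ₐ[F] E) (t : (seriesNilIdeal (maxNilIdeal F E)).toIdeal) :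
    (seriesGalMapPt σ t : PowerSeries (unitBall E)) = seriesGalMap σ t := rfl

/-- `σ(X) = X` as points. [folklore] -/
theorem seriesGalMapPt_serX (σ : E ≃ₐ[F] E) : seriesGalMapPt σ (serX (maxNilIdeal F E)) = serX (maxNilIdeal F E) :=
  Subtype.ext (seriesGalMap_X σ)

/-- `σ(C ω) = C (σ ω)` as points. [folklore] -/
theorem seriesGalMapPt_serC (σ : E ≃ₐ[F] E) (ω : (maxNilIdeal F E).toIdeal) :
    seriesGalMapPt σ (serC (maxNilIdeal F E) ω) = serC (maxNilIdeal F E) (mapPt σ ω) :=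
  Subtype.ext (seriesGalMap_C σ _)

variable {π : 𝒪[F]} {hA : IsLTRing (LTCoeff.of F π) (residueFieldCard F)}

/-- **`σ(X [+] ω) = X [+] σω`.** [folklore] -/
theorem seriesGalMapPt_tPt (σ : E ≃ₐ[F] E) (ω : (maxNilIdeal F E).toIdeal) :
    seriesGalMapPt σ (tPt (maxNilIdeal F E) hA (isLTSeries_LTCoeff π) ω) =
      tPt (maxNilIdeal F E) hA (isLTSeries_LTCoeff π) (mapPt σ ω) := by
  apply Subtype.ext
  change seriesGalMap σ (evalPt (seriesNilIdeal (maxNilIdeal F E)) (formalGroup hA (isLTSeries_LTCoeff π)).toPowerSeries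
    (formalGroup hA (isLTSeries_LTCoeff π)).zero_constantCoeff ![serX _, serC _ ω] : PowerSeries (unitBall E)) =
    (evalPt (seriesNilIdeal (maxNilIdeal F E)) (formalGroup hA (isLTSeries_LTCoeff π)).toPowerSeries
    (formalGroup hA (isLTSeries_LTCoeff π)).zero_constantCoeff ![serX _, serC _ (mapPt σ ω)] : PowerSeries (unitBall E))
  refine algHom_evalPt _ _ (seriesGalMap σ) (continuous_seriesGalMap σ) _ _ _ _ fun i => ?_
  fin_cases i
  · exact seriesGalMap_X σ
  · exact seriesGalMap_C σ _

/-- **`σ(h(X [+] ω)) = h(X [+] σω)`** for `h ∈ 𝒪[F]⟦X⟧`. [folklore] -/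
theorem seriesGalMap_transl (σ : E ≃ₐ[F] E) (ω : (maxNilIdeal F E).toIdeal) (h : PowerSeries (LTCoeff F)) :
    seriesGalMap σ (transl (maxNilIdeal F E) hA (isLTSeries_LTCoeff π) ω h) =
      transl (maxNilIdeal F E) hA (isLTSeries_LTCoeff π) (mapPt σ ω) h := by
  rw [transl, transl]
  exact algHom_evalAt _ _ (seriesGalMap σ) (continuous_seriesGalMap σ) h _ _ (congrArg Subtype.val (seriesGalMapPt_tPt σ ω))

/-- `σ` commutes with `[a]` on points (point-valued form of `toUnitBallHom_ltSMul`). [folklore] -/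
theorem mapPt_ltSMul (σ : E ≃ₐ[F] E) (a : LTCoeff F) (x : (maxNilIdeal F E).toIdeal) :
    mapPt σ (ltSMul (maxNilIdeal F E) hA (isLTSeries_LTCoeff π) a x) =
      ltSMul (maxNilIdeal F E) hA (isLTSeries_LTCoeff π) a (mapPt σ x) :=
  Subtype.ext (toUnitBallHom_ltSMul σ a x)

/-- `mapPt σ` is injective. [folklore] -/
theorem mapPt_injective (σ : E ≃ₐ[F] E) : Function.Injective (mapPt (F := F) (E := E) σ) := by
  intro x y h
  have h1 : σ ((x : unitBall E) : E) = σ ((y : unitBall E) : E) := by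
    rw [← coe_mapPt, ← coe_mapPt, h]
  exact Subtype.ext (Subtype.ext (σ.injective h1))

/-- `mapPt σ 0 = 0`. [folklore] -/
@[simp] theorem mapPt_zero (σ : E ≃ₐ[F] E) : mapPt σ (0 : (maxNilIdeal F E).toIdeal) = 0 := by
  apply Subtype.ext; apply Subtype.ext
  rw [coe_mapPt]
  exact map_zero σ

/-! #### Descent of the Coleman series to `𝒪[F]` -/

variable (hπ : (valuation F).IsUniformizer (π : F)) (n : ℕ)

/-- **Every `π`-division point in `𝔪_{K_π^{n+1}}` is an `ω_c`** (`f(y) = ∏ (y - ω_c)`).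
[cite: CasselsFrohlichANT1967, Ch. VI §3.6 Prop. 6 (a)] -/
theorem exists_eq_ltDivPt {y : (maxNilIdeal F (ltField π n)).toIdeal}
    (hy : ltSMul (maxNilIdeal F (ltField π n)) (isLTRing_LTCoeff hπ) (isLTSeries_LTCoeff π)
      (LTCoeff.of F π) y = 0) : ∃ c : 𝓀[F], y = ltDivPt hπ n c := by
  have h1 : evS (maxNilIdeal F (ltField π n)) y (∏ c : 𝓀[F], (PowerSeries.X - PowerSeries.C
      ((ltDivPt hπ n c : (maxNilIdeal F (ltField π n)).toIdeal) : unitBall (ltField π n)))) = 0 := by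
    rw [← map_ltSeries_eq_prod hπ n, ← evalAt_eq_evS_map,
      ← coe_ltSMul_eq_evalAt (maxNilIdeal F (ltField π n)) (isLTRing_LTCoeff hπ) (isLTSeries_LTCoeff π),
      hy]
    rfl
  rw [map_prod, Finset.prod_eq_zero_iff] at h1
  obtain ⟨c, -, hc⟩ := h1
  rw [map_sub, evS_X, evS_C, sub_eq_zero] at hc
  exact ⟨c, Subtype.ext hc⟩

/-- **`σ` permutes `W_f^1`.** [cite: CasselsFrohlichANT1967, Ch. VI §3.6 Prop. 6 (b) (proof)] -/
theorem exists_perm_mapPt_ltDivPt (σ : ltField π n ≃ₐ[F] ltField π n) :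
    ∃ τ : 𝓀[F] ≃ 𝓀[F], ∀ c, mapPt σ (ltDivPt hπ n c) = ltDivPt hπ n (τ c) := by
  have key : ∀ c, ∃ c', mapPt σ (ltDivPt hπ n c) = ltDivPt hπ n c' := fun c => by
    refine exists_eq_ltDivPt hπ n ?_
    rw [← mapPt_ltSMul, ltSMul_ltDivPt, mapPt_zero]
  choose g hg using key
  have hinj : Function.Injective g := fun c c' h =>
    ltDivPt_injective hπ n (mapPt_injective σ (by rw [hg, hg, h]))
  exact ⟨Equiv.ofBijective g (Finite.injective_iff_bijective.mp hinj), hg⟩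

/-- `σ` fixes the Coleman product `∏_c h(X [+] ω_c)`. [cite: deShalit1987, Ch. I §2.1 (proof)] -/
theorem seriesGalMap_nProd (σ : ltField π n ≃ₐ[F] ltField π n) (h : PowerSeries (LTCoeff F)) :
    seriesGalMap σ (nProd (maxNilIdeal F (ltField π n)) (isLTRing_LTCoeff hπ) (isLTSeries_LTCoeff π)
      (ltDivPt hπ n) h) =
      nProd (maxNilIdeal F (ltField π n)) (isLTRing_LTCoeff hπ) (isLTSeries_LTCoeff π) (ltDivPt hπ n) h := by
  obtain ⟨τ, hτ⟩ := exists_perm_mapPt_ltDivPt hπ n σ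
  rw [nProd, map_prod]
  simp_rw [seriesGalMap_transl, hτ]
  exact Equiv.prod_comp τ (fun c => transl _ (isLTRing_LTCoeff hπ) (isLTSeries_LTCoeff π) (ltDivPt hπ n c) h)

/-- **`σ` fixes Coleman's series `𝒩h`** (uniqueness of the solution of `𝒩h ∘ f = ∏ h(X [+] ω_c)`).
[cite: deShalit1987, Ch. I §2.1 ("(1) characterizes `𝒩h` uniquely")] -/
theorem seriesGalMap_colemanSer (σ : ltField π n ≃ₐ[F] ltField π n) (h : PowerSeries (LTCoeff F)) :
    seriesGalMap σ (colemanSer (isColemanFamily_ltDivPt hπ n) h) = colemanSer (isColemanFamily_ltDivPt hπ n) h := by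
  set S := unitBall (ltField π n)
  set fS := (ltSer F π).map (algebraMap (LTCoeff F) S) with hfS
  have hfS' : IsLTSeries (algebraMap (LTCoeff F) S (LTCoeff.of F π)) (residueFieldCard F) fS :=
    (isLTSeries_ltSer π).map _
  have hπS : algebraMap (LTCoeff F) S (LTCoeff.of F π) ≠ 0 := by
    intro h0
    have h1 := congrArg (fun s : S => (s : ltField π n)) h0
    change algebraMap F (ltField π n) (π : F) = ((0 : S) : ltField π n) at h1
    rw [ZeroMemClass.coe_zero, map_eq_zero] at h1
    exact hπ.ne_zero h1
  refine subst_injective_of_isDomain hπS hfS' ?_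
  change PowerSeries.subst fS (seriesGalMap σ _) = PowerSeries.subst fS _
  have hsub := subst_colemanSer (isColemanFamily_ltDivPt hπ n) h
  rw [← hfS] at hsub
  have hfix : PowerSeries.map (toUnitBallHom σ : S →+* S) fS = fS := by
    rw [← seriesGalMap_apply, hfS, seriesGalMap_map]
  have h1 : PowerSeries.map (toUnitBallHom σ : S →+* S) (PowerSeries.subst fS
      (colemanSer (isColemanFamily_ltDivPt hπ n) h)) = PowerSeries.subst fS (seriesGalMap σ
        (colemanSer (isColemanFamily_ltDivPt hπ n) h)) := by
    have e : PowerSeries.map (toUnitBallHom σ : S →+* S) (PowerSeries.subst fS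
        (colemanSer (isColemanFamily_ltDivPt hπ n) h)) =
        PowerSeries.subst (PowerSeries.map (toUnitBallHom σ : S →+* S) fS)
          (PowerSeries.map (toUnitBallHom σ : S →+* S) (colemanSer (isColemanFamily_ltDivPt hπ n) h)) :=
      PowerSeries.map_subst
        (PowerSeries.HasSubst.of_constantCoeff_zero' hfS'.constantCoeff_eq_zero) _
    rw [hfix] at e
    rw [seriesGalMap_apply]
    exact e
  rw [← h1, hsub, ← seriesGalMap_apply, seriesGalMap_nProd]

/-- Elements of `𝒪_E` fixed by `G(E/F)` come from `𝒪[F]` (`E/F` Galois). [folklore] -/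
theorem exists_algebraMap_eq_of_fixed [IsGalois F E] {s : unitBall E}
    (hs : ∀ σ : E ≃ₐ[F] E, toUnitBallHom σ s = s) :
    ∃ a : 𝒪[F], algebraMap (LTCoeff F) (unitBall E) (LTCoeff.of F a) = s := by
  have h1 : ((s : unitBall E) : E) ∈ Set.range (algebraMap F E) := by
    rw [IsGalois.mem_range_algebraMap_iff_fixed]
    intro σ
    have := congrArg (fun t : unitBall E => (t : E)) (hs σ)
    exact this
  obtain ⟨a, ha⟩ := h1
  have ha1 : ‖a‖ ≤ 1 := by
    rw [← spectralNorm_extends (L := E) a, ← norm_eq_spectralNorm F E, ha]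
    exact (mem_unitBall_iff E).mp s.2
  refine ⟨⟨a, (Valued.toNormedField.norm_le_one_iff).mp ha1⟩, Subtype.ext ?_⟩
  exact ha

/-- **Coleman's norm operator `𝒩` on `𝒪[F]⟦X⟧`** for `f = πX + X^q` (computed inside `K_π^{n+1}`):
the descent to `𝒪[F]` of the Coleman series over `𝒪_{K_π^{n+1}}` (its coefficients are fixed by
`G(K_π^{n+1}/F)`). [cite: deShalit1987, Ch. I §2.1] -/
def colemanNorm (h : PowerSeries (LTCoeff F)) : PowerSeries (LTCoeff F) :=
  haveI := isGalois_ltField hπ n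
  PowerSeries.mk fun k => LTCoeff.of F (exists_algebraMap_eq_of_fixed (E := ltField π n)
    (s := PowerSeries.coeff k (colemanSer (isColemanFamily_ltDivPt hπ n) h)) (fun σ => by
      rw [← coeff_seriesGalMap, seriesGalMap_colemanSer])).choose

/-- `𝒩h` maps to the Coleman series over `𝒪_{K_π^{n+1}}`. [cite: deShalit1987, Ch. I §2.1] -/
theorem map_colemanNorm (h : PowerSeries (LTCoeff F)) :
    (colemanNorm hπ n h).map (algebraMap (LTCoeff F) (unitBall (ltField π n))) =
      colemanSer (isColemanFamily_ltDivPt hπ n) h := by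
  haveI := isGalois_ltField hπ n
  refine PowerSeries.ext fun k => ?_
  rw [PowerSeries.coeff_map, colemanNorm, PowerSeries.coeff_mk]
  exact (exists_algebraMap_eq_of_fixed (E := ltField π n)
    (s := PowerSeries.coeff k (colemanSer (isColemanFamily_ltDivPt hπ n) h)) (fun σ => by
      rw [← coeff_seriesGalMap, seriesGalMap_colemanSer])).choose_spec

end Descent

end LocalField

end Literature.NumberTheory.GaloisRepresentations
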